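import Mathlib.Analysis.Matrix.PosDef

/-!
# Spectral lower bound for `⟪v, T ^ k v⟫` at a normalised eigenvector
(crux `QuarksAsStableAction.StableActionBridge`, item stmt-QuantumFields-9737, line `Sketch`;
registered stub `inner_pow_ge_eigen` of the lead skeleton)

The finite-dimensional atom by which a light state refutes a uniform lattice mass gap
(Goldstone mechanism, clause `IsChiralAtZero`): Lüscher's transfer matrix `T` is a positive
self-adjoint operator; if `T e = λ e` with `⟪e, e⟫ = 1`, then for every vector `v` (think
`v = B̂ Ω`) and every Euclidean time `k`,

  `λ ^ k ‖⟪e, v⟫‖ ² ≤ re ⟪v, T ^ k v⟫`,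

so the two-point function decays no faster than `λ ^ k |⟪e, v⟫|²`.

Matrix form with Mathlib conventions (`Matrix.PosSemidef`, `star e ⬝ᵥ v = Σ conj (eᵢ) vᵢ = ⟪e, v⟫`).
The proof is elementary (no spectral theorem): write `v = u + α e` with `α = ⟪e, v⟫` and
`⟪e, u⟫ = 0`; since `T ^ k e = λ ^ k e` and `T ^ k` is Hermitian both cross terms vanish, the
`e`-term equals `λ ^ k |α|²`, and the `u`-term has nonnegative real part because `T ^ k` is
positive semidefinite (`Matrix.PosSemidef.pow`).
-/

open scoped ComplexOrder
open Matrix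

namespace Summit.QuantumFields.QCD.Cruxes.StableActionBridge.Sketch

/-- An eigenvector of `T` with eigenvalue `c` is an eigenvector of `T ^ k` with eigenvalue
`c ^ k`. [folklore] -/
private theorem pow_mulVec_eq_pow_smul {n : Type} [Fintype n] [DecidableEq n]
    {T : Matrix n n ℂ} {e : n → ℂ} {c : ℂ} (he : T *ᵥ e = c • e) (k : ℕ) :
    (T ^ k) *ᵥ e = (c ^ k) • e := by
  induction k with
  | zero => rw [pow_zero, pow_zero, one_mulVec, one_smul]
  | succ k ih => rw [pow_succ, ← mulVec_mulVec, he, mulVec_smul, ih, smul_smul, ← pow_succ']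

/-- Algebraic core of the spectral lower bound: for a Hermitian `S` with `S e = μ e`,
`⟪e, e⟫ = 1`, and any `v`, splitting `v = u + α e` with `α = ⟪e, v⟫` (so `⟪e, u⟫ = 0`) gives
`⟪v, S v⟫ = ⟪u, S u⟫ + μ |α|²` — the cross terms vanish. [folklore] -/
private theorem dotProduct_mulVec_eigen_split {n : Type} [Fintype n] {S : Matrix n n ℂ}
    (hSH : Sᴴ = S) {e : n → ℂ} {μ : ℂ} (hSe : S *ᵥ e = μ • e) (hee : star e ⬝ᵥ e = 1)
    (v : n → ℂ) :
    star v ⬝ᵥ S *ᵥ v =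
      star (v - (star e ⬝ᵥ v) • e) ⬝ᵥ S *ᵥ (v - (star e ⬝ᵥ v) • e) +
        μ * ((Complex.normSq (star e ⬝ᵥ v) : ℝ) : ℂ) := by
  set α : ℂ := star e ⬝ᵥ v with hα
  set u : n → ℂ := v - α • e with hu
  -- `u ⟂ e`
  have heu : star e ⬝ᵥ u = 0 := by
    rw [hu, dotProduct_sub, dotProduct_smul, hee, smul_eq_mul, mul_one, ← hα, sub_self]
  have hue : star u ⬝ᵥ e = 0 := by rw [star_dotProduct, heu, star_zero]
  -- `S (α e) = (α μ) e`
  have hSw : S *ᵥ (α • e) = (α * μ) • e := by rw [mulVec_smul, hSe, smul_smul]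
  -- the two cross terms vanish
  have h1 : star u ⬝ᵥ S *ᵥ (α • e) = 0 := by rw [hSw, dotProduct_smul, hue, smul_zero]
  have h2 : star (α • e) ⬝ᵥ S *ᵥ u = 0 := by
    have hvS : star (α • e) ᵥ* S = star (S *ᵥ (α • e)) := by rw [star_mulVec, hSH]
    rw [dotProduct_mulVec, hvS, hSw, star_smul, smul_dotProduct, heu, smul_zero]
  -- the `e`-term
  have h3 : star (α • e) ⬝ᵥ S *ᵥ (α • e) = μ * ((Complex.normSq α : ℝ) : ℂ) := by
    rw [hSw, star_smul, smul_dotProduct, dotProduct_smul, hee, smul_eq_mul, smul_eq_mul, mul_one,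
      Complex.normSq_eq_conj_mul_self, starRingEnd_apply]
    ring
  have hv : v = u + α • e := by rw [hu, sub_add_cancel]
  conv_lhs => rw [hv]
  rw [mulVec_add, star_add, add_dotProduct, dotProduct_add, dotProduct_add, h1, h2, h3, add_zero,
    zero_add]

/-- **Spectral lower bound at a light state (Goldstone atom).** If `T` is a positive-semidefinite
complex matrix, `T e = λ e` with `λ` real and `⟪e, e⟫ = star e ⬝ᵥ e = 1`, then for every `v` and
every `k : ℕ`, `λ ^ k ‖star e ⬝ᵥ v‖ ² ≤ re (star v ⬝ᵥ (T ^ k) v)`: the vacuum two-point function of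
`v` along the transfer matrix decays no faster than `λ ^ k |⟪e, v⟫|²`. [folklore] -/
theorem inner_pow_ge_eigen : ∀ (n : Type) [Fintype n] [DecidableEq n] (T : Matrix n n ℂ), T.PosSemidef → ∀ (e v : n → ℂ) (lam : ℝ) (k : ℕ), T.mulVec e = (lam : ℂ) • e → star e ⬝ᵥ e = 1 → lam ^ k * ‖star e ⬝ᵥ v‖ ^ 2 ≤ (star v ⬝ᵥ (T ^ k).mulVec v).re := by
  intro n _ _ T hT e v lam k he hee
  have hS : (T ^ k).PosSemidef := hT.pow k
  have hSe : (T ^ k) *ᵥ e = ((lam : ℂ) ^ k) • e := pow_mulVec_eq_pow_smul he k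
  -- `⟪v, T^k v⟫ = ⟪u, T^k u⟫ + λ^k |α|²` with `u = v - α e`, `α = ⟪e, v⟫`
  have key := dotProduct_mulVec_eigen_split hS.isHermitian.eq hSe hee v
  -- the `u`-term has nonnegative real part
  have hu : 0 ≤ (star (v - (star e ⬝ᵥ v) • e) ⬝ᵥ
      (T ^ k) *ᵥ (v - (star e ⬝ᵥ v) • e)).re := by
    have h := hS.re_dotProduct_nonneg (v - (star e ⬝ᵥ v) • e)
    rwa [RCLike.re_to_complex] at h
  -- the `e`-term is real and equals `λ^k ‖α‖²`
  have hre : (((lam : ℂ) ^ k) * ((Complex.normSq (star e ⬝ᵥ v) : ℝ) : ℂ)).re =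
      lam ^ k * ‖star e ⬝ᵥ v‖ ^ 2 := by
    rw [← Complex.ofReal_pow, ← Complex.ofReal_mul, Complex.ofReal_re, Complex.normSq_eq_norm_sq]
  rw [key, Complex.add_re, hre]
  linarith
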